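import Literature.NumberTheory.Irrationality.LaiLupuSprang2025.RationalFunction
import Literature.NumberTheory.Irrationality.PAdicZetaValues.VolkenbornDeltaOperator
import Literature.NumberTheory.Irrationality.PAdicZetaValues.HurwitzReflectionProofs
import Literature.NumberTheory.LocalFields.PadicExpLogDerivatives
import HarnessLib

/-!
# Lai–Lupu–Sprang 2025, §4: the linear forms `S_{j/p} = −∫_{ℤ_p} R̃_n(t + j/p) dt` (Definition 4.2) and
# `S_n = Σ_{j=1}^{p−1} S_{j/p}` (Definition 4.4); Lemma 4.3 and Lemma 4.5 — PROVED

Topic `Literature/NumberTheory/Irrationality/LaiLupuSprang2025`.  Source: L. Lai, C. Lupu, J. Sprang, *On the irrationality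
of certain `p`-adic zeta values*, Res. Math. Sci. 12 (2025) = arXiv:2505.23088 [LaiLupuSprang2025], §2.2–2.3 (Volkenborn
integral, translation formula Lemma 2.2, `ζ_p(s,x) = (1/(s−1))∫⟨t+x⟩^{1−s}dt`, Lemma 2.5), §3 (3.3) (the primitive `R̃_n`)
and §4 (held text `paper:arxiv-2505.23088`, chunks p0004–p0006, read on the page).  PROOF FILE (definitions with bodies +
theorems; no named fact, net debt 0): fourth file of the discharge of the tree's named fact
`PAdicZetaValues.laiLupuSprang2025_theorem11`, on the sibling `RationalFunction.lean` (`coeffR = r_{i,k}`, `rho = ρ_i`,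
`rhoZeroJ = ρ_{0,j/p}`, `rhoZero = ρ_0`, `rho_one_eq_zero` = Lemma 4.1) and the tree's Volkenborn calculus
(`LocalFields.volkenbornSum/volkenbornIntegral`, the translation formula `PAdicZetaValues.tendsto_volkenbornSum_shift_nat`,
Sprang's Lemma 3.1 `sprang2020_lemma31_holds`, the reflection formula `padicHurwitzZeta_one_sub`, Lemma 2.7
`lai2025TwoAdic_lemma27_holds`, and the `p`-adic logarithm `PadicExp.plog` with `hasDerivAt_plog`).

## Source, as printed ([LaiLupuSprang2025, §3 (3.3), §4])

* (3.3): «`R̃_n(t) := Σ_{k=1}^{n} r_{1,k} log_p⟨t+k⟩ + Σ_{i=2}^{p−1+s} Σ_{k=1}^{n} r_{i,k}/((1−i)(t+k)^{i−1})` … the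
  derivative of `R̃_n(t)` coinciides with `R_n(t)`» (`log_p` the Iwasawa logarithm, `⟨x⟩ = x/ω(x)`).
* **Lemma 4.1.** «Define `ρ_1 := Σ_k r_{1,k}`.  Then we have `ρ_1 = 0`.»  (tree: `rho_one_eq_zero`.)
* **Definition 4.2.** «For any `j ∈ {1,…,p−1}`, we define `S_{j/p} := −∫_{ℤ_p} R̃_n(t + j/p) dt`.»
* **Lemma 4.3.** «For any `j ∈ {1,…,p−1}`, we have `S_{j/p} = ρ_{0,j/p} + Σ_{i=2}^{p−1+s} ρ_i · ω(j/p)^{1−i} ζ_p(i, j/p)`,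
  where `ρ_i := Σ_{k=1}^{n} r_{i,k}` … and `ρ_{0,j/p} := −Σ_{i=1}^{p−1+s}Σ_{k=1}^{n}Σ_{ν=0}^{k−1} r_{i,k}/(ν + j/p)^i`.»
  *Proof.* «`S_{j/p} = −Σ_k r_{1,k}∫log_p⟨t+k+j/p⟩dt − Σ_{i≥2}Σ_k r_{i,k}∫dt/((1−i)(t+k+j/p)^{i−1})` [(4.5)].  By
  Lemma 2.2, `∫log_p⟨t+k+j/p⟩dt = ∫log_p⟨t+j/p⟩dt + Σ_{ν<k} 1/(ν+j/p)` [(4.6)], and using (eq:zeta_Volkenborn),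
  `∫dt/((1−i)(t+k+j/p)^{i−1}) = ∫dt/((1−i)(t+j/p)^{i−1}) + Σ_{ν<k}(ν+j/p)^{−i} = −ω(j/p)^{1−i}ζ_p(i,j/p) + Σ_{ν<k}(ν+j/p)^{−i}`
  [(4.7)].  Substituting … we obtain `S_{j/p} = ρ_{0,j/p} + Σ_i ρ_i ω(j/p)^{1−i}ζ_p(i,j/p) − ρ_1·∫log_p⟨t+j/p⟩dt`.  Since
  `ρ_1 = 0` by Lemma 4.1, the proof is complete.»
* **Definition 4.4.** «`S_n := Σ_{j=1}^{p−1} S_{j/p}`.»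
* **Lemma 4.5.** «`S_n = ρ_0 + Σ_{3 ≤ i ≤ p−1+s, i odd} ρ_i · p^i ζ_p(i)`, where `ρ_0 := Σ_{j=1}^{p−1} ρ_{0,j/p}`.»  *Proof.*
  «By Lemma 4.3 and Lemma 2.5 [`D^i ζ_p(i) = Σ_{1≤j≤D,(j,p)=1} ω(j/D)^{1−i}ζ_p(i,j/D)` at `D = p`] …  Since `ζ_p(2k) = 0`
  for every positive integer `k`, the proof is complete.»

## What is formalised (all PROVED; `p` an odd prime where the Hurwitz values enter)

* `xj p j = j/p ∈ ℚ_p` (`‖j/p‖_p = p = q_p` for `p ∤ j`); the two kinds of summands of `R̃_n(t + j/p)`: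
  the power pieces `(x + k + t)^{1−i}` — `tendsto_volkenbornSum_zpow_one_sub` (**(eq:zeta_Volkenborn)**:
  `∫(x+t)^{1−i}dt = (i−1)ω(x)^{1−i}ζ_p(i,x)`, Sprang's Lemma 3.1 in the tree) and `tendsto_volkenbornSum_zpow_one_sub_shift`
  (**(4.7)**, by the translation formula Lemma 2.2 = tree `tendsto_volkenbornSum_shift_nat`); and the logarithmic pieces
  `Lx x t = log_p(1 + t/x)` — `hasSum_Lx` (the logarithmic series, a restricted power series in `t`),
  `exists_tendsto_volkenbornSum_Lx` (Volkenborn integrable, tree `tendsto_volkenbornSum_powerSeries`), `hasDerivAt_Lx`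
  (`(log_p(1 + y/x))′ = 1/(x+y)`) and `tendsto_volkenbornSum_Lx_shift` (**(4.6)**).
  READING OF (3.3) (flagged): for `t ∈ ℤ_p`, `log_p⟨t+k+j/p⟩ = log_p⟨j/p⟩ + log_p(1 + (t+k)/(j/p))` (`⟨·⟩` is multiplicative up
  to the root of unity `ω`, killed by `log_p`), and `Σ_k r_{1,k} log_p⟨j/p⟩ = ρ_1 log_p⟨j/p⟩ = 0` by Lemma 4.1; so
  `R̃_n(t + j/p) = Rtil p s n j t` below EXACTLY, written without a choice of branch of `log_p` on `p^ℤ`.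
* **(3.3)/(4.4)** `Rtil p s n j : ℤ_p → ℚ_p` (`= R̃_n(t + j/p)`), **Definition 4.2** `Sj p s n j := −∫_{ℤ_p} Rtil`,
  **Definition 4.4** `Sn p s n := Σ_{j=1}^{p−1} Sj`; `tendsto_volkenbornSum_Rtil` (the Riemann sums converge, value computed) and
  **Lemma 4.3** `Sj_eq`: `S_{j/p} = ρ_{0,j/p} + Σ_{i=2}^{p−1+s} ρ_i ω(j/p)^{1−i} ζ_p(i, j/p)` (under the degree condition of
  Lemma 4.1, which gives `ρ_1 = 0`).
* **Lemma 2.5 at `D = p`**, split by parity: `sum_teichmuller_zpow_mul_hurwitz_odd`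
  (`Σ_{j=1}^{p−1} ω(j/p)^{1−i}ζ_p(i,j/p) = p^i ζ_p(i)`, odd `i ≥ 3`, from the tree's Lemma 2.7 `lai2025TwoAdic_lemma27_holds` and
  `ω(j/p) = ω(j)/p`) and `sum_teichmuller_zpow_mul_hurwitz_even` (`= 0` for even `i ≥ 2`: the pairing `j ↔ p − j`,
  `ω(1−x) = −ω(x)`, `ζ_p(i,1−x) = ζ_p(i,x)` — the tree's reflection formula; this is the printed «`ζ_p(2k) = 0`»).
* **Lemma 4.5** `Sn_eq`: `S_n = ρ_0 + Σ_{i ∈ [2,p−1+s], i odd} ρ_i p^i ζ_p(i)` with the TREE's `padicZetaValue p i`.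

Cell zeta5-irr / pub-zeta5 (HONEST FRAMING: systematic search; no irrationality claim unless kernel-certified): `p`-adic
linear forms of a PUBLISHED proof; nothing here bears on `ζ(5) ∈ ℝ`.
-/

noncomputable section

open Finset Filter Topology
open Literature.NumberTheory.LocalFields
open Literature.NumberTheory.Transcendental (PadicExp.plog PadicExp.hasSum_plog)
open Literature.NumberTheory.Irrationality.PAdicZetaValues

namespace Literature.NumberTheory.Irrationality.LaiLupuSprang2025

variable {p : ℕ} [hp : Fact p.Prime]

/-! ## §1. The points `j/p` and elementary norms -/

/-- The point `x = j/p ∈ ℚ_p`. [cite: LaiLupuSprang2025, Definition 4.2] -/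
def xj (p : ℕ) [Fact p.Prime] (j : ℕ) : ℚ_[p] := (j : ℚ_[p]) / (p : ℚ_[p])

omit hp in
/-- `q_p = p` for odd `p`. [cite: LaiLupuSprang2025, §2.3 ("Let p be an odd prime")] -/
theorem qp_eq_of_ne_two (hp2 : p ≠ 2) : qp p = p := by rw [qp, if_neg hp2]

/-- `‖j/p‖_p = p` for `p ∤ j`. [cite: LaiLupuSprang2025, §2.3 (`|x|_p > 1` at `x = j/p`)] -/
theorem norm_xj {j : ℕ} (hj : ¬ p ∣ j) : ‖xj p j‖ = p := by
  have h := norm_natCast_div_pow (p := p) hj 0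
  simp only [zero_add, pow_one] at h
  rw [xj]
  exact_mod_cast h

/-- `q_p ≤ ‖j/p‖_p` (odd `p`, `p ∤ j`). [cite: LaiLupuSprang2025, §2.3] -/
theorem qp_le_norm_xj (hp2 : p ≠ 2) {j : ℕ} (hj : ¬ p ∣ j) : ((qp p : ℕ) : ℝ) ≤ ‖xj p j‖ := by
  rw [qp_eq_of_ne_two hp2, norm_xj hj]

/-- `1 < ‖j/p‖_p` for `p ∤ j`. [cite: LaiLupuSprang2025, §2.3] -/
theorem one_lt_norm_xj {j : ℕ} (hj : ¬ p ∣ j) : 1 < ‖xj p j‖ := by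
  rw [norm_xj hj]; exact_mod_cast hp.out.one_lt

omit hp in
/-- For `1 ≤ j < p`: `p ∤ j`. [cite: LaiLupuSprang2025, §4 (`j ∈ {1,…,p−1}`)] -/
theorem not_dvd_of_mem_Ico {j : ℕ} (hj : j ∈ Ico 1 p) : ¬ p ∣ j := by
  intro h
  have := Nat.le_of_dvd (by have := (mem_Ico.1 hj).1; omega) h
  have := (mem_Ico.1 hj).2
  omega

/-- `‖m‖_p ≤ 1` for natural `m`. [folklore] -/
private theorem norm_natCast_le_one' (m : ℕ) : ‖(m : ℚ_[p])‖ ≤ 1 := by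
  have h := Padic.norm_int_le_one (p := p) (m : ℤ)
  rwa [Int.cast_natCast] at h

/-- For `‖x‖_p > 1` and `‖y‖_p ≤ 1`: `‖x + y‖_p = ‖x‖_p`. [folklore] -/
private theorem norm_add_eq_of_norm_le_one {x y : ℚ_[p]} (hx : 1 < ‖x‖) (hy : ‖y‖ ≤ 1) : ‖x + y‖ = ‖x‖ := by
  have hne : ‖x‖ ≠ ‖y‖ := ne_of_gt (hy.trans_lt hx)
  rw [Padic.add_eq_max_of_ne hne, max_eq_left (hy.trans hx.le)]

/-- `x + y ≠ 0` for `‖x‖_p > 1`, `‖y‖_p ≤ 1`. [folklore] -/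
private theorem add_ne_zero_of_norm {x y : ℚ_[p]} (hx : 1 < ‖x‖) (hy : ‖y‖ ≤ 1) : x + y ≠ 0 := by
  rw [← norm_pos_iff, norm_add_eq_of_norm_le_one hx hy]; exact zero_lt_one.trans hx

/-! ## §2. The power pieces: `∫_{ℤ_p}(x+t)^{1−i}dt = (i−1)ω(x)^{1−i}ζ_p(i,x)` and its translates ((4.7)) -/

/-- **(eq:zeta_Volkenborn)**: for `|x|_p ≥ q_p` and `i ≥ 2`, the Riemann sums of `(x+t)^{1−i}` converge to
`(i−1)·ω(x)^{1−i}·ζ_p(i,x)` (Sprang's Lemma 3.1 in the tree). [cite: LaiLupuSprang2025, §2.3 (eq:zeta_Volkenborn) and Lemma 4.3 (4.7)] -/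
theorem tendsto_volkenbornSum_zpow_one_sub {x : ℚ_[p]} (hx : ((qp p : ℕ) : ℝ) ≤ ‖x‖) {i : ℕ} (hi : 2 ≤ i) :
    Tendsto (volkenbornSum p (fun t : ℤ_[p] => (x + (t : ℚ_[p])) ^ (1 - (i : ℤ)))) atTop
      (𝓝 ((((i : ℚ_[p]) - 1) * teichmuller p x ^ (1 - (i : ℤ)) * padicHurwitzZeta p i x))) := by
  obtain ⟨V, hV, hVeq⟩ := sprang2020_lemma31_holds p i x (by omega) hx
  have hi0 : ((i : ℚ_[p]) - 1) ≠ 0 := by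
    rw [sub_ne_zero]; exact_mod_cast (show i ≠ 1 by omega)
  have hval : ((i : ℚ_[p]) - 1) * teichmuller p x ^ (1 - (i : ℤ)) * padicHurwitzZeta p i x = V := by
    rw [mul_assoc, hVeq]; field_simp
  rw [hval]
  refine hV.congr fun r => ?_
  rw [volkenbornSum_def, smul_eq_mul, ← zpow_natCast, ← zpow_neg]
  simp only [PadicInt.coe_natCast]

/-- **(4.7)** — the translates: for `k ∈ ℕ` the Riemann sums of `(x+k+t)^{1−i}` converge to
`(i−1)ω(x)^{1−i}ζ_p(i,x) + Σ_{ν<k}(1−i)(x+ν)^{−i}` (translation formula Lemma 2.2, `f(t) = (x+t)^{1−i}`,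
`f′(ν) = (1−i)(x+ν)^{−i}`). [cite: LaiLupuSprang2025, Lemma 2.2 and Lemma 4.3 (4.7)] -/
theorem tendsto_volkenbornSum_zpow_one_sub_shift {x : ℚ_[p]} (hx : ((qp p : ℕ) : ℝ) ≤ ‖x‖) {i : ℕ} (hi : 2 ≤ i)
    (k : ℕ) :
    Tendsto (volkenbornSum p (fun t : ℤ_[p] => (x + k + (t : ℚ_[p])) ^ (1 - (i : ℤ)))) atTop
      (𝓝 ((((i : ℚ_[p]) - 1) * teichmuller p x ^ (1 - (i : ℤ)) * padicHurwitzZeta p i x) +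
        ∑ ν ∈ range k, (1 - (i : ℚ_[p])) * ((x + ν) ^ i)⁻¹)) := by
  have hx1 : 1 < ‖x‖ := one_lt_norm_of_qp_le hx
  set f : ℤ_[p] → ℚ_[p] := fun t => (x + (t : ℚ_[p])) ^ (1 - (i : ℤ)) with hf
  have hI := tendsto_volkenbornSum_zpow_one_sub hx hi
  have h := tendsto_volkenbornSum_shift_nat (p := p) (f := f)
    (D := fun ν => (1 - (i : ℚ_[p])) * ((x + ν) ^ i)⁻¹) k hI ?_
  · have hfun : (fun t : ℤ_[p] => f (t + (k : ℤ_[p]))) = fun t : ℤ_[p] => (x + k + (t : ℚ_[p])) ^ (1 - (i : ℤ)) := by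
      funext t
      simp only [hf, PadicInt.coe_add, PadicInt.coe_natCast]
      ring_nf
    rw [hfun] at h
    exact h
  intro ν _
  have hx0 : x + (ν : ℚ_[p]) ≠ 0 := add_ne_zero_of_norm hx1 (norm_natCast_le_one' ν)
  have hderiv : HasDerivAt (fun y : ℚ_[p] => (x + y) ^ (1 - (i : ℤ)))
      ((((1 - (i : ℤ) : ℤ)) : ℚ_[p]) * (x + (ν : ℚ_[p])) ^ ((1 - (i : ℤ)) - 1)) (ν : ℚ_[p]) := by
    have h := hasDerivAt_zpow (1 - (i : ℤ)) (x + (ν : ℚ_[p])) (Or.inl hx0)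
    exact h.comp_const_add x (ν : ℚ_[p])
  have hlim := tendsto_pow_inv_smul_sub_of_hasDerivAt (p := p) hderiv
  have hval : (((1 - (i : ℤ) : ℤ)) : ℚ_[p]) * (x + (ν : ℚ_[p])) ^ ((1 - (i : ℤ)) - 1) =
      (1 - (i : ℚ_[p])) * ((x + ν) ^ i)⁻¹ := by
    rw [show (1 - (i : ℤ)) - 1 = -(i : ℤ) by ring, zpow_neg, zpow_natCast]
    push_cast
    ring
  rw [hval] at hlim
  refine hlim.congr fun r => ?_
  simp only [hf, PadicInt.coe_add, PadicInt.coe_natCast]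
  push_cast
  ring_nf

/-! ## §3. The logarithmic pieces `log_p(1 + t/x)` ((4.6)) -/

/-- `log_p(1 + t/x)` on `ℤ_p` (`|x|_p > 1`): the function `t ↦ log_p⟨t + x⟩ − log_p⟨x⟩` of (3.3)/(4.5).
[cite: LaiLupuSprang2025, §3 (3.3) and Lemma 4.3 (4.5)–(4.6)] -/
def Lx (x : ℚ_[p]) (t : ℤ_[p]) : ℚ_[p] := PadicExp.plog (1 + (t : ℚ_[p]) / x)

/-- `‖y/x‖_p < 1` for `‖y‖_p ≤ 1 < ‖x‖_p`. [folklore] -/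
private theorem norm_div_lt_one {x y : ℚ_[p]} (hx : 1 < ‖x‖) (hy : ‖y‖ ≤ 1) : ‖y / x‖ < 1 := by
  rw [norm_div, div_lt_one (zero_lt_one.trans hx)]
  exact hy.trans_lt hx

/-- The coefficients of the logarithmic series of `log_p(1 + t/x)` in powers of `t`:
`a_0 = 0`, `a_{m+1} = (−1)^m x^{−(m+1)}/(m+1)`. [cite: LaiLupuSprang2025, §2.2 (overconvergent power series)] -/
def logCoeff (x : ℚ_[p]) : ℕ → ℚ_[p]
  | 0 => 0
  | m + 1 => (-1) ^ m * (x ^ (m + 1))⁻¹ / ((m : ℚ_[p]) + 1)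

/-- **`log_p(1 + t/x) = Σ_m a_m t^m`** (the logarithmic series, `|t/x|_p < 1`). [cite: LaiLupuSprang2025, §2.2–2.3] -/
theorem hasSum_Lx {x : ℚ_[p]} (hx : 1 < ‖x‖) (t : ℤ_[p]) :
    HasSum (fun m : ℕ => ((t : ℚ_[p]) ^ m) • logCoeff x m) (Lx x t) := by
  have hy : ‖(1 : ℚ_[p]) - (1 + (t : ℚ_[p]) / x)‖ < 1 := by
    rw [show (1 : ℚ_[p]) - (1 + (t : ℚ_[p]) / x) = -((t : ℚ_[p]) / x) by ring, norm_neg]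
    exact norm_div_lt_one hx (PadicInt.norm_le_one t)
  have h := PadicExp.hasSum_plog (ℓ := p) hy
  have hx0 : x ≠ 0 := by rw [← norm_pos_iff]; exact zero_lt_one.trans hx
  have hfun : ∀ m : ℕ, -((1 - (1 + (t : ℚ_[p]) / x)) ^ (m + 1)) / ((m : ℚ_[p]) + 1) =
      ((t : ℚ_[p]) ^ (m + 1)) • logCoeff x (m + 1) := by
    intro m
    simp only [logCoeff, smul_eq_mul]
    rw [show (1 : ℚ_[p]) - (1 + (t : ℚ_[p]) / x) = -((t : ℚ_[p]) / x) by ring, neg_pow, div_pow]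
    field_simp
    ring
  simp_rw [hfun] at h
  have h0 : logCoeff x 0 = 0 := rfl
  unfold Lx
  refine (hasSum_nat_add_iff' 1).1 ?_
  simpa [h0] using h

/-- `1/n ≤ ‖n‖_p` for `n ≥ 1` (`p^{v_p(n)} ≤ n`). [folklore] -/
private theorem one_div_le_norm_natCast {n : ℕ} (hn : n ≠ 0) : (1 : ℝ) / n ≤ ‖(n : ℚ_[p])‖ := by
  have hv : ‖(n : ℚ_[p])‖ = (p : ℝ) ^ (-(padicValNat p n : ℤ)) := by
    rw [Padic.norm_eq_zpow_neg_valuation (by exact_mod_cast hn), Padic.valuation_natCast]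
  rw [hv, zpow_neg, zpow_natCast, one_div]
  have hpp : (0 : ℝ) < p := by exact_mod_cast hp.out.pos
  have hp0 : (0 : ℝ) < (p : ℝ) ^ padicValNat p n := by positivity
  refine inv_anti₀ hp0 ?_
  exact_mod_cast Nat.le_of_dvd (Nat.pos_of_ne_zero hn) pow_padicValNat_dvd

/-- `‖1/(m+1)‖_p ≤ m+1`. [folklore] -/
private theorem norm_inv_natCast_succ_le (m : ℕ) : ‖(((m : ℚ_[p]) + 1))⁻¹‖ ≤ (m : ℝ) + 1 := by
  have hm : ((m : ℚ_[p]) + 1) = ((m + 1 : ℕ) : ℚ_[p]) := by push_cast; ring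
  rw [hm, norm_inv]
  have hge := one_div_le_norm_natCast (p := p) (Nat.succ_ne_zero m)
  have hpos : (0 : ℝ) < 1 / ((m + 1 : ℕ) : ℝ) := by positivity
  calc ‖((m + 1 : ℕ) : ℚ_[p])‖⁻¹ ≤ (1 / ((m + 1 : ℕ) : ℝ))⁻¹ := inv_anti₀ hpos hge
    _ = (m : ℝ) + 1 := by rw [one_div, inv_inv]; push_cast; ring

/-- The coefficients `a_m → 0` (`‖a_{m+1}‖_p ≤ (m+1)‖x‖^{−(m+1)}`): the logarithmic series is a restricted power series
on `ℤ_p`. [cite: LaiLupuSprang2025, §2.2 ("Q_p-analytic functions of radius of convergence at least ρ")] -/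
theorem tendsto_logCoeff_zero {x : ℚ_[p]} (hx : 1 < ‖x‖) : Tendsto (logCoeff x) atTop (𝓝 0) := by
  have hx0 : 0 < ‖x‖ := zero_lt_one.trans hx
  set r : ℝ := ‖x‖⁻¹ with hr
  have hr0 : 0 ≤ r := by positivity
  have hr1 : r < 1 := inv_lt_one_of_one_lt₀ hx
  have hlim : Tendsto (fun m : ℕ => ((m : ℝ) + 1) * r ^ (m + 1)) atTop (𝓝 0) := by
    have h := (tendsto_add_atTop_iff_nat 1).2 (tendsto_self_mul_const_pow_of_lt_one hr0 hr1)
    refine h.congr fun m => ?_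
    push_cast; ring
  rw [← tendsto_add_atTop_iff_nat 1]
  refine squeeze_zero_norm (fun m => ?_) hlim
  simp only [logCoeff]
  rw [norm_div, norm_mul, norm_pow, norm_neg, norm_one, one_pow, one_mul, norm_inv, norm_pow, div_eq_mul_inv,
    ← norm_inv]
  calc (‖x‖ ^ (m + 1))⁻¹ * ‖((m : ℚ_[p]) + 1)⁻¹‖ ≤ (‖x‖ ^ (m + 1))⁻¹ * ((m : ℝ) + 1) :=
        mul_le_mul_of_nonneg_left (norm_inv_natCast_succ_le m) (by positivity)
    _ = ((m : ℝ) + 1) * r ^ (m + 1) := by rw [hr, inv_pow]; ring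

/-- `log_p(1 + t/x)` as the sum of its power series. [cite: LaiLupuSprang2025, §2.2] -/
theorem Lx_eq_tsum {x : ℚ_[p]} (hx : 1 < ‖x‖) :
    Lx x = fun t : ℤ_[p] => ∑' m : ℕ, ((t : ℚ_[p]) ^ m) • logCoeff x m :=
  funext fun t => ((hasSum_Lx hx t).tsum_eq).symm

/-- **`t ↦ log_p(1 + t/x)` is Volkenborn integrable** (`|x|_p > 1`): its Riemann sums converge, to `Σ_m B_m a_m` (the tree's
term-by-term integration of restricted power series). [cite: LaiLupuSprang2025, §2.2 ("every strictly differentiable function is Volkenborn integrable") and §4 (4.5)] -/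
theorem tendsto_volkenbornSum_Lx {x : ℚ_[p]} (hx : 1 < ‖x‖) :
    Tendsto (volkenbornSum p (Lx x)) atTop
      (𝓝 (∑' m : ℕ, (((bernoulli m : ℚ) : ℚ_[p])) • logCoeff x m)) := by
  rw [Lx_eq_tsum hx]
  exact tendsto_volkenbornSum_powerSeries (tendsto_logCoeff_zero hx)

/-- `(log_p(1 + y/x))′ = 1/(x + y)` for `‖y‖_p ≤ 1 < ‖x‖_p` (the derivative `1/(ν + j/p)` in (4.6)).
[cite: LaiLupuSprang2025, Lemma 4.3 (4.6) (f′(ν) = 1/(ν + j/p))] -/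
theorem hasDerivAt_Lx {x : ℚ_[p]} (hx : 1 < ‖x‖) {y : ℚ_[p]} (hy : ‖y‖ ≤ 1) :
    HasDerivAt (fun y : ℚ_[p] => PadicExp.plog (1 + y / x)) ((x + y)⁻¹) y := by
  have hx0 : x ≠ 0 := by rw [← norm_pos_iff]; exact zero_lt_one.trans hx
  have hxy : x + y ≠ 0 := add_ne_zero_of_norm hx hy
  have h1 : HasDerivAt (fun y : ℚ_[p] => 1 + y / x) (1 / x) y := ((hasDerivAt_id y).div_const x).const_add 1
  have hY : ‖(1 : ℚ_[p]) - (1 + y / x)‖ < 1 := by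
    rw [show (1 : ℚ_[p]) - (1 + y / x) = -(y / x) by ring, norm_neg]; exact norm_div_lt_one hx hy
  have h2 := hasDerivAt_plog (p := p) hY
  have h := h2.comp y h1
  have hval : (1 + y / x)⁻¹ * (1 / x) = (x + y)⁻¹ := by
    field_simp
  rw [hval] at h
  exact h

/-- **(4.6)** — the translates: if the Riemann sums of `log_p(1 + t/x)` tend to `I`, those of `log_p(1 + (t+k)/x)` tend to
`I + Σ_{ν<k} 1/(x+ν)` (Lemma 2.2). [cite: LaiLupuSprang2025, Lemma 2.2 and Lemma 4.3 (4.6)] -/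
theorem tendsto_volkenbornSum_Lx_shift {x : ℚ_[p]} (hx : 1 < ‖x‖) {I : ℚ_[p]}
    (hI : Tendsto (volkenbornSum p (Lx x)) atTop (𝓝 I)) (k : ℕ) :
    Tendsto (volkenbornSum p (fun t : ℤ_[p] => Lx x (t + k))) atTop (𝓝 (I + ∑ ν ∈ range k, (x + ν)⁻¹)) := by
  refine tendsto_volkenbornSum_shift_nat (f := Lx x) (D := fun ν : ℕ => (x + ν)⁻¹) k hI fun ν _ => ?_
  have hlim := tendsto_pow_inv_smul_sub_of_hasDerivAt (p := p) (hasDerivAt_Lx hx (norm_natCast_le_one' ν))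
  refine hlim.congr fun r => ?_
  simp only [Lx, PadicInt.coe_add, PadicInt.coe_natCast]
  push_cast
  ring_nf

/-! ## §4. `R̃_n(t + j/p)`, the linear forms `S_{j/p}`, `S_n`, and Lemma 4.3 -/

/-- **`R̃_n(t + j/p)`** ((3.3) translated by `j/p`, for `t ∈ ℤ_p`):
`Σ_k r_{1,k} log_p(1 + (t+k)/(j/p)) + Σ_{i=2}^{p−1+s} Σ_k (r_{i,k}/(1−i)) (j/p + k + t)^{1−i}` (see the module docstring for
the reading of `log_p⟨t+k+j/p⟩`; the `k = 0` terms vanish, `r_{i,0} = 0`). [cite: LaiLupuSprang2025, §3 (3.3) and Definition 4.2] -/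
def Rtil (p : ℕ) [Fact p.Prime] (s n j : ℕ) (t : ℤ_[p]) : ℚ_[p] :=
  ∑ k ∈ range (n + 1), (((coeffR p s n 1 k : ℚ) : ℚ_[p]) * Lx (xj p j) (t + k) +
    ∑ i ∈ Icc 2 (p - 1 + s), ((coeffR p s n i k / (1 - i) : ℚ) : ℚ_[p]) * (xj p j + k + (t : ℚ_[p])) ^ (1 - (i : ℤ)))

/-- **Definition 4.2**: `S_{j/p} := −∫_{ℤ_p} R̃_n(t + j/p) dt`. [cite: LaiLupuSprang2025, Definition 4.2] -/
def Sj (p : ℕ) [Fact p.Prime] (s n j : ℕ) : ℚ_[p] := -volkenbornIntegral p (Rtil p s n j)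

/-- **Definition 4.4**: `S_n := Σ_{j=1}^{p−1} S_{j/p}`. [cite: LaiLupuSprang2025, Definition 4.4] -/
def Sn (p : ℕ) [Fact p.Prime] (s n : ℕ) : ℚ_[p] := ∑ j ∈ Ico 1 p, Sj p s n j

/-- Scalars pull out of Riemann sums. [cite: LaiLupuSprang2025, §2.2 (linearity of the Volkenborn integral)] -/
theorem volkenbornSum_const_mul (c : ℚ_[p]) (f : ℤ_[p] → ℚ_[p]) (N : ℕ) :
    volkenbornSum p (fun t => c * f t) N = c * volkenbornSum p f N := by
  simpa only [smul_eq_mul] using volkenbornSum_smul c f N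

/-- The Riemann sums of `R̃_n(t + j/p)` in terms of those of its pieces ((4.5)). [cite: LaiLupuSprang2025, Lemma 4.3 (4.5)] -/
theorem volkenbornSum_Rtil (s n j N : ℕ) :
    volkenbornSum p (Rtil p s n j) N =
      ∑ k ∈ range (n + 1), (((coeffR p s n 1 k : ℚ) : ℚ_[p]) * volkenbornSum p (fun t : ℤ_[p] => Lx (xj p j) (t + k)) N +
        ∑ i ∈ Icc 2 (p - 1 + s), ((coeffR p s n i k / (1 - i) : ℚ) : ℚ_[p]) *
          volkenbornSum p (fun t : ℤ_[p] => (xj p j + k + (t : ℚ_[p])) ^ (1 - (i : ℤ))) N) := by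
  unfold Rtil
  rw [volkenbornSum_finset_sum]
  refine sum_congr rfl fun k _ => ?_
  rw [volkenbornSum_add, volkenbornSum_const_mul, volkenbornSum_finset_sum]
  congr 1
  refine sum_congr rfl fun i _ => ?_
  rw [volkenbornSum_const_mul]

/-- **The Riemann sums of `R̃_n(t + j/p)` converge** (odd `p`, `1 ≤ j < p`), to
`Σ_k [r_{1,k}(I_j + Σ_{ν<k}(j/p+ν)^{−1}) + Σ_i (r_{i,k}/(1−i))((i−1)ω(j/p)^{1−i}ζ_p(i,j/p) + Σ_{ν<k}(1−i)(j/p+ν)^{−i})]`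
with `I_j = ∫log_p(1 + t/(j/p))dt`. [cite: LaiLupuSprang2025, Lemma 4.3 (proof: (4.5)–(4.7))] -/
theorem tendsto_volkenbornSum_Rtil (hp2 : p ≠ 2) {j : ℕ} (hj : j ∈ Ico 1 p) (s n : ℕ) :
    Tendsto (volkenbornSum p (Rtil p s n j)) atTop
      (𝓝 (∑ k ∈ range (n + 1), (((coeffR p s n 1 k : ℚ) : ℚ_[p]) *
          ((∑' m : ℕ, (((bernoulli m : ℚ) : ℚ_[p])) • logCoeff (xj p j) m) + ∑ ν ∈ range k, (xj p j + ν)⁻¹) +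
        ∑ i ∈ Icc 2 (p - 1 + s), ((coeffR p s n i k / (1 - i) : ℚ) : ℚ_[p]) *
          ((((i : ℚ_[p]) - 1) * teichmuller p (xj p j) ^ (1 - (i : ℤ)) * padicHurwitzZeta p i (xj p j)) +
            ∑ ν ∈ range k, (1 - (i : ℚ_[p])) * ((xj p j + ν) ^ i)⁻¹)))) := by
  have hjd := not_dvd_of_mem_Ico hj
  have hx1 : 1 < ‖xj p j‖ := one_lt_norm_xj hjd
  have hxq : ((qp p : ℕ) : ℝ) ≤ ‖xj p j‖ := qp_le_norm_xj hp2 hjd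
  have hfun : volkenbornSum p (Rtil p s n j) = fun N =>
      ∑ k ∈ range (n + 1), (((coeffR p s n 1 k : ℚ) : ℚ_[p]) * volkenbornSum p (fun t : ℤ_[p] => Lx (xj p j) (t + k)) N +
        ∑ i ∈ Icc 2 (p - 1 + s), ((coeffR p s n i k / (1 - i) : ℚ) : ℚ_[p]) *
          volkenbornSum p (fun t : ℤ_[p] => (xj p j + k + (t : ℚ_[p])) ^ (1 - (i : ℤ))) N) :=
    funext fun N => volkenbornSum_Rtil s n j N
  rw [hfun]
  refine tendsto_finsetSum _ fun k _ => ?_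
  refine ((tendsto_volkenbornSum_Lx_shift hx1 (tendsto_volkenbornSum_Lx hx1) k).const_mul _).add ?_
  refine tendsto_finsetSum _ fun i hi => ?_
  exact (tendsto_volkenbornSum_zpow_one_sub_shift hxq (mem_Icc.1 hi).1 k).const_mul _

/-- The `i = 1` part of `ρ_{0,j/p}` in `ℚ_p`. [cite: LaiLupuSprang2025, Lemma 4.3 (4.4)] -/
theorem cast_rhoZeroJ_one (s n j : ℕ) :
    (((∑ k ∈ range (n + 1), ∑ ν ∈ range k, coeffR p s n 1 k / ((ν : ℚ) + (j : ℚ) / p) ^ 1 : ℚ)) : ℚ_[p]) =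
      ∑ k ∈ range (n + 1), ((coeffR p s n 1 k : ℚ) : ℚ_[p]) * ∑ ν ∈ range k, (xj p j + ν)⁻¹ := by
  push_cast
  refine sum_congr rfl fun k _ => ?_
  rw [mul_sum]
  refine sum_congr rfl fun ν _ => ?_
  simp only [xj]
  ring

/-- The `i ≥ 2` part of `ρ_{0,j/p}` in `ℚ_p`. [cite: LaiLupuSprang2025, Lemma 4.3 (4.4)] -/
theorem cast_rhoZeroJ_two (s n j : ℕ) :
    (((∑ i ∈ Icc 2 (p - 1 + s), ∑ k ∈ range (n + 1), ∑ ν ∈ range k,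
        coeffR p s n i k / ((ν : ℚ) + (j : ℚ) / p) ^ i : ℚ)) : ℚ_[p]) =
      ∑ k ∈ range (n + 1), ∑ i ∈ Icc 2 (p - 1 + s), ((coeffR p s n i k : ℚ) : ℚ_[p]) *
        ∑ ν ∈ range k, ((xj p j + ν) ^ i)⁻¹ := by
  push_cast
  rw [sum_comm]
  refine sum_congr rfl fun k _ => sum_congr rfl fun i _ => ?_
  rw [mul_sum]
  refine sum_congr rfl fun ν _ => ?_
  simp only [xj]
  ring

/-- `ρ_{0,j/p}` in `ℚ_p`: `−Σ_k r_{1,k}Σ_{ν<k}(j/p+ν)^{−1} − Σ_kΣ_{i≥2} r_{i,k}Σ_{ν<k}(j/p+ν)^{−i}` (the `i = 1` term split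
off; `p − 1 + s ≥ 1`). [cite: LaiLupuSprang2025, Lemma 4.3 (4.4)] -/
theorem cast_rhoZeroJ {s : ℕ} (hps : 1 ≤ p - 1 + s) (n j : ℕ) :
    ((rhoZeroJ p s n j : ℚ) : ℚ_[p]) =
      -(∑ k ∈ range (n + 1), ((coeffR p s n 1 k : ℚ) : ℚ_[p]) * ∑ ν ∈ range k, (xj p j + ν)⁻¹) -
        ∑ k ∈ range (n + 1), ∑ i ∈ Icc 2 (p - 1 + s), ((coeffR p s n i k : ℚ) : ℚ_[p]) *
          ∑ ν ∈ range k, ((xj p j + ν) ^ i)⁻¹ := by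
  have hIcc : Icc 1 (p - 1 + s) = insert 1 (Icc 2 (p - 1 + s)) :=
    (Finset.insert_Icc_add_one_left_eq_Icc hps).symm
  have h1 : (1 : ℕ) ∉ Icc 2 (p - 1 + s) := by simp
  unfold rhoZeroJ
  rw [hIcc, sum_insert h1, Rat.cast_neg, Rat.cast_add, cast_rhoZeroJ_one, cast_rhoZeroJ_two]
  ring

/-- **Lemma 4.3**: `S_{j/p} = ρ_{0,j/p} + Σ_{i=2}^{p−1+s} ρ_i · ω(j/p)^{1−i} ζ_p(i, j/p)` (odd `p`, `1 ≤ j < p`; under the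
degree condition of Lemma 4.1, which gives `ρ_1 = 0`). [cite: LaiLupuSprang2025, Lemma 4.3] -/
theorem Sj_eq (hp2 : p ≠ 2) {j : ℕ} (hj : j ∈ Ico 1 p) (s n : ℕ)
    (hdeg : M0 p s + (p - 1) * n + 2 ≤ (p - 1 + s) * (n + 1)) :
    Sj p s n j = ((rhoZeroJ p s n j : ℚ) : ℚ_[p]) +
      ∑ i ∈ Icc 2 (p - 1 + s), ((rho p s n i : ℚ) : ℚ_[p]) *
        (teichmuller p (xj p j) ^ (1 - (i : ℤ)) * padicHurwitzZeta p i (xj p j)) := by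
  have hp1 : 2 ≤ p := hp.out.two_le
  have hρ1 : ∑ k ∈ range (n + 1), ((coeffR p s n 1 k : ℚ) : ℚ_[p]) = 0 := by
    rw [← Rat.cast_sum]
    have h := rho_one_eq_zero (p := p) (by omega) s n hdeg
    rw [rho] at h
    rw [h, Rat.cast_zero]
  have hρ : ∀ i, ((rho p s n i : ℚ) : ℚ_[p]) = ∑ k ∈ range (n + 1), ((coeffR p s n i k : ℚ) : ℚ_[p]) := by
    intro i; rw [rho, Rat.cast_sum]
  -- the `i ≥ 2` pieces: `(r/(1−i))·((i−1)ωζ + (1−i)B) = −rωζ + rB`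
  have hci : ∀ i ∈ Icc 2 (p - 1 + s), ∀ k : ℕ,
      ((coeffR p s n i k / (1 - i) : ℚ) : ℚ_[p]) *
        ((((i : ℚ_[p]) - 1) * teichmuller p (xj p j) ^ (1 - (i : ℤ)) * padicHurwitzZeta p i (xj p j)) +
          ∑ ν ∈ range k, (1 - (i : ℚ_[p])) * ((xj p j + ν) ^ i)⁻¹) =
      -(((coeffR p s n i k : ℚ) : ℚ_[p]) * (teichmuller p (xj p j) ^ (1 - (i : ℤ)) * padicHurwitzZeta p i (xj p j))) +
        ((coeffR p s n i k : ℚ) : ℚ_[p]) * ∑ ν ∈ range k, ((xj p j + ν) ^ i)⁻¹ := by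
    intro i hi k
    have hi2 := (mem_Icc.1 hi).1
    have hi1 : (1 : ℚ_[p]) - i ≠ 0 := by
      rw [sub_ne_zero, ne_comm]; exact_mod_cast (show i ≠ 1 by omega)
    have hcast : ((coeffR p s n i k / (1 - i) : ℚ) : ℚ_[p]) =
        ((coeffR p s n i k : ℚ) : ℚ_[p]) / (1 - (i : ℚ_[p])) := by
      rw [Rat.cast_div, Rat.cast_sub, Rat.cast_one, Rat.cast_natCast]
    rw [hcast, ← mul_sum]
    field_simp
    ring
  rw [Sj, volkenbornIntegral_eq (tendsto_volkenbornSum_Rtil hp2 hj s n), cast_rhoZeroJ (by omega) n j,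
    sum_add_distrib, sum_congr rfl fun k _ => sum_congr rfl fun i hi => hci i hi k]
  have hT1 : ∑ k ∈ range (n + 1), ((coeffR p s n 1 k : ℚ) : ℚ_[p]) *
      ((∑' m : ℕ, (((bernoulli m : ℚ) : ℚ_[p])) • logCoeff (xj p j) m) + ∑ ν ∈ range k, (xj p j + ν)⁻¹) =
      ∑ k ∈ range (n + 1), ((coeffR p s n 1 k : ℚ) : ℚ_[p]) * ∑ ν ∈ range k, (xj p j + ν)⁻¹ := by
    simp_rw [mul_add]
    rw [sum_add_distrib, ← sum_mul, hρ1, zero_mul, zero_add]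
  have hT3 : ∑ k ∈ range (n + 1), ∑ i ∈ Icc 2 (p - 1 + s),
      (-(((coeffR p s n i k : ℚ) : ℚ_[p]) * (teichmuller p (xj p j) ^ (1 - (i : ℤ)) * padicHurwitzZeta p i (xj p j))) +
        ((coeffR p s n i k : ℚ) : ℚ_[p]) * ∑ ν ∈ range k, ((xj p j + ν) ^ i)⁻¹) =
      -(∑ i ∈ Icc 2 (p - 1 + s), ((rho p s n i : ℚ) : ℚ_[p]) *
          (teichmuller p (xj p j) ^ (1 - (i : ℤ)) * padicHurwitzZeta p i (xj p j))) +
        ∑ k ∈ range (n + 1), ∑ i ∈ Icc 2 (p - 1 + s), ((coeffR p s n i k : ℚ) : ℚ_[p]) *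
          ∑ ν ∈ range k, ((xj p j + ν) ^ i)⁻¹ := by
    simp_rw [sum_add_distrib, sum_neg_distrib]
    congr 1
    rw [sum_comm]
    simp_rw [hρ, sum_mul]
  rw [hT1, hT3]
  ring

/-! ## §5. Lemma 2.5 at `D = p` (by parity) and Lemma 4.5 -/

/-- `ω(j/p) = ω(j)/p` for `p ∤ j`. [cite: LaiLupuSprang2025, §2.3 ("ω(x) := p^{v_p(x)}ω(x/p^{v_p(x)})")] -/
theorem teichmuller_xj {j : ℕ} (hj : ¬ p ∣ j) :
    teichmuller p (xj p j) = teichmuller p (j : ℚ_[p]) / (p : ℚ_[p]) := by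
  have h := teichmuller_natCast_div_pow (p := p) hj 0
  simp only [zero_add, pow_one] at h
  rw [xj]
  exact h

omit hp in
/-- The unit classes modulo `p`: `{a < p : p ∤ a} = {1, …, p−1}`. [cite: LaiLupuSprang2025, Lemma 2.5 ("1 ≤ j ≤ D, (j,p) = 1" at D = p)] -/
theorem filter_range_not_dvd (p : ℕ) : (range p).filter (fun a => ¬ p ∣ a) = Ico 1 p := by
  ext a
  simp only [mem_filter, mem_range, mem_Ico]
  constructor
  · rintro ⟨hap, hnd⟩
    refine ⟨Nat.pos_of_ne_zero fun h => hnd (h ▸ dvd_zero p), hap⟩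
  · rintro ⟨ha1, hap⟩
    exact ⟨hap, fun h => by have := Nat.le_of_dvd ha1 h; omega⟩

/-- **Lemma 2.5 at `D = p`, odd `i ≥ 3`**: `Σ_{j=1}^{p−1} ω(j/p)^{1−i} ζ_p(i, j/p) = p^i ζ_p(i)` — from the tree's Lemma 2.7
(`ζ_p(i) = (1/p)Σ_a ω(a)^{1−i}ζ_p(i,a/p)`) and `ω(j/p) = ω(j)/p`. [cite: LaiLupuSprang2025, Lemma 2.5 and Lemma 4.5 (proof)] -/
theorem sum_teichmuller_zpow_mul_hurwitz_odd (hp2 : p ≠ 2) {i : ℕ} (hi : Odd i) (h3 : 3 ≤ i) :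
    ∑ j ∈ Ico 1 p, teichmuller p (xj p j) ^ (1 - (i : ℤ)) * padicHurwitzZeta p i (xj p j) =
      (p : ℚ_[p]) ^ i * padicZetaValue p i := by
  have hp0 : (p : ℚ_[p]) ≠ 0 := by exact_mod_cast hp.out.ne_zero
  have hL := lai2025TwoAdic_lemma27_holds p i hi h3
  rw [qp_eq_of_ne_two hp2, filter_range_not_dvd p] at hL
  rw [hL, ← mul_assoc, mul_sum]
  refine sum_congr rfl fun a ha => ?_
  rw [teichmuller_xj (not_dvd_of_mem_Ico ha), div_zpow, xj, zpow_sub₀ hp0, zpow_one, zpow_natCast]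
  field_simp

/-- **Lemma 2.5 at `D = p`, even `i ≥ 2`: the sum vanishes** (`Σ_{j=1}^{p−1} ω(j/p)^{1−i}ζ_p(i,j/p) = p^iζ_p(i) = 0`, «`ζ_p(2k) =
0`»): the pairing `j ↔ p − j`, `ω(1 − x) = −ω(x)`, `ζ_p(i, 1 − x) = ζ_p(i, x)` (the tree's reflection formula).
[cite: LaiLupuSprang2025, Lemma 2.5 and Lemma 4.5 (proof: "Since ζ_p(2k) = 0 for every positive integer k")] -/
theorem sum_teichmuller_zpow_mul_hurwitz_even (hp2 : p ≠ 2) {i : ℕ} (hi : Even i) (h2 : 2 ≤ i) :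
    ∑ j ∈ Ico 1 p, teichmuller p (xj p j) ^ (1 - (i : ℤ)) * padicHurwitzZeta p i (xj p j) = 0 := by
  have hp0 : (p : ℚ_[p]) ≠ 0 := by exact_mod_cast hp.out.ne_zero
  set g : ℕ → ℚ_[p] := fun j => teichmuller p (xj p j) ^ (1 - (i : ℤ)) * padicHurwitzZeta p i (xj p j) with hg
  have hodd : Odd (1 - (i : ℤ)) := by
    obtain ⟨k, hk⟩ := hi
    exact ⟨-(k : ℤ), by rw [hk]; push_cast; ring⟩
  have hrefl : ∀ j ∈ Ico 1 p, g (p - j) = -g j := by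
    intro j hj
    have hjd := not_dvd_of_mem_Ico hj
    have hjp : j ≤ p := (mem_Ico.1 hj).2.le
    have hx : xj p (p - j) = 1 - xj p j := by
      simp only [xj]
      rw [Nat.cast_sub hjp]
      field_simp
    simp only [hg]
    rw [hx, teichmuller_one_sub (qp_le_norm_xj hp2 hjd), hodd.neg_zpow,
      padicHurwitzZeta_one_sub h2 (qp_le_norm_xj hp2 hjd)]
    ring
  have hsum : ∑ j ∈ Ico 1 p, g j = ∑ j ∈ Ico 1 p, g (p - j) := by
    refine sum_nbij' (fun j => p - j) (fun j => p - j) ?_ ?_ ?_ ?_ ?_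
    · intro a ha; rw [mem_Ico] at ha ⊢; omega
    · intro a ha; rw [mem_Ico] at ha ⊢; omega
    · intro a ha; rw [mem_Ico] at ha; omega
    · intro a ha; rw [mem_Ico] at ha; omega
    · intro a ha
      rw [mem_Ico] at ha
      rw [show p - (p - a) = a by omega]
  rw [sum_congr rfl hrefl, sum_neg_distrib] at hsum
  have h2S : (2 : ℚ_[p]) * ∑ j ∈ Ico 1 p, g j = 0 := by linear_combination hsum
  exact (mul_eq_zero.1 h2S).resolve_left two_ne_zero

/-- **Lemma 4.5**: `S_n = ρ_0 + Σ_{3 ≤ i ≤ p−1+s, i odd} ρ_i · p^i ζ_p(i)` (odd `p`, degree condition of Lemma 4.1), with the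
TREE's `padicZetaValue p i`; the sum is written over the odd `i ∈ [2, p−1+s]`. [cite: LaiLupuSprang2025, Lemma 4.5] -/
theorem Sn_eq (hp2 : p ≠ 2) (s n : ℕ) (hdeg : M0 p s + (p - 1) * n + 2 ≤ (p - 1 + s) * (n + 1)) :
    Sn p s n = ((rhoZero p s n : ℚ) : ℚ_[p]) +
      ∑ i ∈ (Icc 2 (p - 1 + s)).filter (fun i => Odd i),
        ((rho p s n i : ℚ) : ℚ_[p]) * ((p : ℚ_[p]) ^ i * padicZetaValue p i) := by
  unfold Sn
  rw [sum_congr rfl fun j hj => Sj_eq hp2 hj s n hdeg, sum_add_distrib, rhoZero, Rat.cast_sum]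
  congr 1
  rw [sum_comm, sum_filter]
  refine sum_congr rfl fun i hi => ?_
  have hi2 := (mem_Icc.1 hi).1
  rw [← mul_sum]
  split_ifs with hodd
  · have h3 : 3 ≤ i := by obtain ⟨k, hk⟩ := hodd; omega
    rw [sum_teichmuller_zpow_mul_hurwitz_odd hp2 hodd h3]
  · rw [sum_teichmuller_zpow_mul_hurwitz_even hp2 (Nat.not_odd_iff_even.1 hodd) hi2, mul_zero]

end Literature.NumberTheory.Irrationality.LaiLupuSprang2025

end
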